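import Summits.PneNP.PneNP.Theorems.SfmBlMachineDictGraph
import Summits.PneNP.PneNP.Theorems.SfmBlMachineSpotsSpec
import Summits.PneNP.PneNP.Theorems.SfmBlDensityTest

/-!
# Line «sfm-bl», MACHINE LAYER M5 dictionary (D2a): the computed spot decomposition — labelling, sides, density, cover (stmt-PneNP-20523)

FRONTIER F-N1c; nothing here bears on P vs NP.

From the machine's extraction state `(labels, r)` (M2b `SfmBlMachine.extract`: one label per leg, `0` = remainder,
`s + 1` = spot `s`, labels `≤ r`) this file defines the DECOMPOSITION DATA of `SfmBl.cutCertified_of_pipeline` over the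
piece structure of D1: `pM e : Option (Fin r)` (the part of leg `e`), `V₁M s`, `V₂M s` (the endpoint pieces of the
legs of spot `s`), and proves three of the five clauses: (sides) `srcM_mem_V₁M`/`dstM_mem_V₂M`, (covered)
`card_V₁M_add_card_V₂M_le`, and (dense) `dense_V₁M_V₂M` from the spot history `SpotInv` of M2c (each spot was
extracted from a candidate pair inside which all its legs run, with `γsq·|W₁|·|W₂| < (#legs)²`) and p3's
`sfmBl_dense_iff_nat` (γsq = 3600·(6000·2^60) = γ_sp²).  Bookkeeping: `card_filter_pM_eq_some` (#legs of spot `s`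
= `labels.count (s+1)`).  The sparseness clause (hsp) is D2b.
-/

set_option linter.dupNamespace false -- `Summit.PneNP.PneNP.…`: summit = sub-problem name (D-0017 single-conjunct layout)

namespace Summit.PneNP.PneNP.Theorems.SfmBlMachine

open Literature.Computability.Complexity
open Summit.PneNP.PneNP.Theorems.Nc03AvoidResidualCoreCandFewHeadsRungFP (trips)

variable {n m : ℕ}

/-! ## The labelling of the legs -/

/-- The label of leg `e` in a label list (one label per leg index `3j + t`). -/
def labOf (labels : List ℕ) (e : Fin m × Fin 3) : ℕ := labels.getD (legIdx e) 0

/-- The PART of leg `e`: `none` = remainder (label `0`), `some s` = spot `s` (label `s + 1`); needs labels `≤ r`. -/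
def pM (labels : List ℕ) (r : ℕ) (hlab : ∀ lab ∈ labels, lab ≤ r) (e : Fin m × Fin 3) : Option (Fin r) :=
  if h : labOf labels e = 0 then none
  else some ⟨labOf labels e - 1, by
    have hle : labOf labels e ≤ r := by
      unfold labOf
      rw [List.getD_eq_getElem?_getD]
      cases hget : labels[legIdx e]? with
      | none => simp
      | some a => simpa [hget] using hlab a (List.mem_of_getElem? hget)
    omega⟩

/-- `pM e = none` iff the label is `0`. -/
theorem pM_eq_none_iff (labels : List ℕ) (r : ℕ) (hlab : ∀ lab ∈ labels, lab ≤ r) (e : Fin m × Fin 3) :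
    pM labels r hlab e = none ↔ labOf labels e = 0 := by
  unfold pM
  split_ifs with h
  · exact ⟨fun _ => h, fun _ => rfl⟩
  · exact ⟨fun h' => absurd h' (by simp), fun h' => absurd h' h⟩

/-- `pM e = some s` iff the label is `s + 1`. -/
theorem pM_eq_some_iff (labels : List ℕ) (r : ℕ) (hlab : ∀ lab ∈ labels, lab ≤ r) (e : Fin m × Fin 3) (s : Fin r) :
    pM labels r hlab e = some s ↔ labOf labels e = s.val + 1 := by
  unfold pM
  split_ifs with h
  · constructor
    · intro h'; exact absurd h' (by simp)
    · intro h'; omega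
  · rw [Option.some.injEq]
    constructor
    · intro h'; have := congrArg Fin.val h'; simp at this; omega
    · intro h'; apply Fin.ext; simp; omega

/-! ## The sides of the spots -/

section Sides

variable (L : ℕ) (I : LocalMap 3 n m) (labels : List ℕ) (r : ℕ) (hlab : ∀ lab ∈ labels, lab ≤ r)

/-- Left side of spot `s`: the left pieces of its legs. -/
def V₁M (s : Fin r) : Finset (LPiece L I) :=
  (Finset.univ.filter fun e => pM labels r hlab e = some s).image (srcM L I)

/-- Right side of spot `s`: the right pieces of its legs. -/
def V₂M (s : Fin r) : Finset (RPiece L I) :=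
  (Finset.univ.filter fun e => pM labels r hlab e = some s).image (dstM L I)

/-- Clause (sides), left. -/
theorem srcM_mem_V₁M {s : Fin r} {e : Fin m × Fin 3} (h : pM labels r hlab e = some s) :
    srcM L I e ∈ V₁M L I labels r hlab s :=
  Finset.mem_image.2 ⟨e, Finset.mem_filter.2 ⟨Finset.mem_univ _, h⟩, rfl⟩

/-- Clause (sides), right. -/
theorem dstM_mem_V₂M {s : Fin r} {e : Fin m × Fin 3} (h : pM labels r hlab e = some s) :
    dstM L I e ∈ V₂M L I labels r hlab s :=
  Finset.mem_image.2 ⟨e, Finset.mem_filter.2 ⟨Finset.mem_univ _, h⟩, rfl⟩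

/-- Clause (covered): `|V₁ s| + |V₂ s| ≤ 2·#(legs of spot s)`. -/
theorem card_V₁M_add_card_V₂M_le (s : Fin r) :
    (V₁M L I labels r hlab s).card + (V₂M L I labels r hlab s).card
      ≤ 2 * (Finset.univ.filter fun e : Fin m × Fin 3 => pM labels r hlab e = some s).card := by
  unfold V₁M V₂M
  have h1 := Finset.card_image_le (s := Finset.univ.filter fun e : Fin m × Fin 3 => pM labels r hlab e = some s)
    (f := srcM L I)
  have h2 := Finset.card_image_le (s := Finset.univ.filter fun e : Fin m × Fin 3 => pM labels r hlab e = some s)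
    (f := dstM L I)
  omega

end Sides

/-! ## Counting legs of a spot through the label list -/

/-- Counting in a list through its indices. -/
theorem count_eq_length_filter_range (a : ℕ) : ∀ l : List ℕ,
    l.count a = ((List.range l.length).filter fun i => l.getD i 0 = a).length
  | [] => by simp
  | x :: l => by
    have ih := count_eq_length_filter_range a l
    rw [List.count_cons, List.length_cons, List.range_succ_eq_map, List.filter_cons]
    have hmap : ((List.range l.length).map Nat.succ).filter (fun i => decide ((x :: l).getD i 0 = a))
        = ((List.range l.length).filter fun i => decide (l.getD i 0 = a)).map Nat.succ := by
      rw [List.filter_map]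
      congr 1
    by_cases h : x = a
    · subst h
      simp only [List.getD_cons_zero, decide_true, if_true, List.length_cons, List.length_map, hmap, beq_self_eq_true]
      omega
    · have hb : (x == a) = false := by simpa using h
      simp only [List.getD_cons_zero, h, decide_false, hmap, List.length_map, hb, Bool.false_eq_true, if_false]
      omega

/-- The legs satisfying a property of their index are as many as the indices `< 3m` with that property. -/
theorem card_filter_legIdx (P : ℕ → Prop) [DecidablePred P] :
    (Finset.univ.filter fun e : Fin m × Fin 3 => P (legIdx e)).card
      = ((List.range (3 * m)).filter fun i => decide (P i)).length := by
  classical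
  have himg : (Finset.univ.filter fun e : Fin m × Fin 3 => P (legIdx e)).image legIdx
      = (Finset.range (3 * m)).filter P := by
    ext i
    rw [Finset.mem_image, Finset.mem_filter, Finset.mem_range]
    constructor
    · rintro ⟨e, he, rfl⟩
      rw [Finset.mem_filter] at he
      exact ⟨legIdx_lt e, he.2⟩
    · rintro ⟨hi, hP⟩
      refine ⟨(⟨i / 3, by omega⟩, ⟨i % 3, by omega⟩), Finset.mem_filter.2 ⟨Finset.mem_univ _, ?_⟩, ?_⟩
      · have : legIdx ((⟨i / 3, by omega⟩, ⟨i % 3, by omega⟩) : Fin m × Fin 3) = i := by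
          unfold legIdx; simp only; omega
        rw [this]; exact hP
      · unfold legIdx; simp only; omega
  rw [← Finset.card_image_of_injective _ legIdx_injective, himg]
  rfl

/-- **#(legs of spot s) = the number of labels equal to `s + 1`.** -/
theorem card_filter_pM_eq_some (labels : List ℕ) (r : ℕ) (hlab : ∀ lab ∈ labels, lab ≤ r)
    (hlen : labels.length = 3 * m) (s : Fin r) :
    (Finset.univ.filter fun e : Fin m × Fin 3 => pM labels r hlab e = some s).card = labels.count (s.val + 1) := by
  have : (Finset.univ.filter fun e : Fin m × Fin 3 => pM labels r hlab e = some s)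
      = Finset.univ.filter fun e : Fin m × Fin 3 => labels.getD (legIdx e) 0 = s.val + 1 :=
    Finset.filter_congr fun e _ => pM_eq_some_iff labels r hlab e s
  rw [this, card_filter_legIdx (m := m) (fun i => labels.getD i 0 = s.val + 1), count_eq_length_filter_range, hlen]

/-! ## Clause (dense) -/

/-- The left side of spot `s` lies inside the left side of the candidate pair it was extracted from. -/
theorem card_V₁M_le_of_spotInv (L : ℕ) (I : LocalMap 3 n m) (labels : List ℕ) (r : ℕ)
    (hlab : ∀ lab ∈ labels, lab ≤ r) (hlen : labels.length = 3 * m) (s : Fin r) (W : Cand)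
    (hgeo : ∀ (i : ℕ) (hi : i < labels.length) (hp : i < (pieceLegs L (trips I)).length),
      labels[i] = s.val + 1 → labL (pieceLegs L (trips I))[i] ∈ W.1 ∧ labR (pieceLegs L (trips I))[i] ∈ W.2) :
    (V₁M L I labels r hlab s).card ≤ W.1.length ∧ (V₂M L I labels r hlab s).card ≤ W.2.length := by
  classical
  have key : ∀ e : Fin m × Fin 3, pM labels r hlab e = some s →
      labL (plegOf L I e) ∈ W.1 ∧ labR (plegOf L I e) ∈ W.2 := by
    intro e he
    rw [pM_eq_some_iff] at he
    have hi : legIdx e < labels.length := by rw [hlen]; exact legIdx_lt e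
    have hp : legIdx e < (pieceLegs L (trips I)).length := by rw [length_pieceLegs, length_trips]; exact legIdx_lt e
    have hlabi : labels[legIdx e] = s.val + 1 := by
      unfold labOf at he; rwa [List.getD_eq_getElem _ _ hi] at he
    have h := hgeo (legIdx e) hi hp hlabi
    rwa [pieceLegs_getElem] at h
  constructor
  · calc (V₁M L I labels r hlab s).card = ((V₁M L I labels r hlab s).image Subtype.val).card :=
          (Finset.card_image_of_injective _ Subtype.val_injective).symm
      _ ≤ W.1.toFinset.card := Finset.card_le_card (fun P hP => by
          obtain ⟨x, hx, rfl⟩ := Finset.mem_image.1 hP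
          unfold V₁M at hx
          obtain ⟨e, he, rfl⟩ := Finset.mem_image.1 hx
          exact List.mem_toFinset.2 (key e (Finset.mem_filter.1 he).2).1)
      _ ≤ W.1.length := List.toFinset_card_le _
  · calc (V₂M L I labels r hlab s).card = ((V₂M L I labels r hlab s).image Subtype.val).card :=
          (Finset.card_image_of_injective _ Subtype.val_injective).symm
      _ ≤ W.2.toFinset.card := Finset.card_le_card (fun P hP => by
          obtain ⟨x, hx, rfl⟩ := Finset.mem_image.1 hP
          unfold V₂M at hx
          obtain ⟨e, he, rfl⟩ := Finset.mem_image.1 hx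
          exact List.mem_toFinset.2 (key e (Finset.mem_filter.1 he).2).2)
      _ ≤ W.2.length := List.toFinset_card_le _

/-- **Clause (dense) for the COMPUTED decomposition**: every spot of an extraction state carrying the spot
invariant `SpotInv` of M2c (e.g. `extract …`, by `spotInv_extract`) with `γsq = 3600·(6000·2^60) = γ_sp²` is
dense in the pipeline's sense. -/
theorem dense_V₁M_V₂M (L : ℕ) (I : LocalMap 3 n m) (cs : List Cand) (st : List ℕ × ℕ)
    (hlab : ∀ lab ∈ st.1, lab ≤ st.2) (hlen : st.1.length = 3 * m)
    (hS : SpotInv (3600 * (6000 * 2 ^ 60)) (pieceLegs L (trips I)) cs st) (s : Fin st.2) :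
    (60 * Real.sqrt (6000 * 2 ^ 60)) *
        Real.sqrt (((V₁M L I st.1 st.2 hlab s).card : ℝ) * ((V₂M L I st.1 st.2 hlab s).card : ℝ))
      < ((Finset.univ.filter fun e : Fin m × Fin 3 => pM st.1 st.2 hlab e = some s).card : ℝ) := by
  obtain ⟨W, _, hgeo, hdense⟩ := hS s.val s.isLt
  obtain ⟨h1, h2⟩ := card_V₁M_le_of_spotInv L I st.1 st.2 hlab hlen s W hgeo
  rw [card_filter_pM_eq_some st.1 st.2 hlab hlen s]
  refine (SfmBl.sfmBl_dense_iff_nat _ _ _).2 ?_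
  calc 3600 * (6000 * 2 ^ 60) * (V₁M L I st.1 st.2 hlab s).card * (V₂M L I st.1 st.2 hlab s).card
      ≤ 3600 * (6000 * 2 ^ 60) * W.1.length * W.2.length :=
        Nat.mul_le_mul (Nat.mul_le_mul_left _ h1) h2
    _ < st.1.count (s.val + 1) * st.1.count (s.val + 1) := hdense

end Summit.PneNP.PneNP.Theorems.SfmBlMachine
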